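import Mathlib.Algebra.Polynomial.Coeff
import Mathlib.Algebra.BigOperators.NatAntidiagonal
import Mathlib.Algebra.BigOperators.Intervals
import Mathlib.Analysis.SpecificLimits.Normed
import Mathlib.Analysis.Asymptotics.Lemmas
import Mathlib.Analysis.SpecialFunctions.Pow.Real
import Literature.Computability.AlgebraicComplexity.SchoenhageTau
import Literature.Computability.AlgebraicComplexity.SchoenhageTauProofs
import Literature.Computability.AlgebraicComplexity.SchoenhageTauBini
import Literature.Computability.AlgebraicComplexity.AsymptoticSpectrum
import Literature.Computability.AlgebraicComplexity.TensorMultiples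
import HarnessLib

/-!
# Border rank to rank: products and powers of approximate decompositions (Bläser 2013, §6)

Topic `Literature/Computability/AlgebraicComplexity`.  Bottom layer of the decomposition of the
named fact `vxxz2024_omega_le` (`RectangularExponent.lean`; Vassilevska Williams–Xu–Xu–Zhou 2024,
§3.6: "It is known from Coppersmith and Winograd [CW90] that `R̃(CW_q) ≤ q + 2`"): the passage from a
BORDER rank bound (an order-`h` approximate decomposition over `K[ε]`, `SchoenhageTau.approxRank`,
Bläser 2013, Def. 6.1) to RANK bounds for all Kronecker powers, which is how every laser-method
bound (CW90, …, VXXZ 2024) feeds Schönhage's asymptotic sum inequality.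

## Main results (all proved)

Built on `SchoenhageTauBini.lean` (Bläser 2013, Thm. 6.3(3): `R_{h+h'}(s ⊗ t) ≤ R_h(s) R_{h'}(t)`,
`approxRank_kroneckerTensor_le`; restriction `approxRank_precomp_le`) and `SchoenhageTauProofs.lean`
(Lemma 6.4: `R(t) ≤ C(h+2,2) R_h(t)`, `tensorRank_le_choose_mul_approxRank`):

* `approxRank_le_card_of_coeff` — an approximate decomposition indexed by any finite type `σ`
  bounds `R_h(t)` by `|σ|` (bookkeeping for explicit decompositions such as Coppersmith–Winograd's).
* `approxRank_kroneckerPow_le` — **`R_{Nh}(t^{⊗N}) ≤ R_h(t)^N`** for arbitrary tensors (the step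
  "`R_{3hs}(⟨N^s,N^s,N^s⟩) ≤ r^{3s}`" of the proof of Bläser's Thm. 6.6, there for matrix tensors).
* `tensorRank_kroneckerPow_le_of_approxRank_le` — `R_h(t) ≤ r ⇒ R(t^{⊗N}) ≤ C(Nh+2, 2) · r^N`
  (BCS 1997, proof of Lemma (15.27): "`R(φ^{⊗N}) ≤ (Nq)² r^N`"), and its growth form
  `isBigO_tensorRank_kroneckerPow_of_approxRank_le` / `…_of_algBorderRank_le`:
  `R(t^{⊗N}) = O(r^{(1+ε)N})` for every `ε > 0` (`r ≥ 2`) — BCS Lemma (15.27)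
  "`limsup_N (1/N) log R(φ^{⊗N}) ≤ log bR(φ)`" in the unfolded form consumed by
  `CoppersmithWinograd1990_asymptoticRank_form` (`CoppersmithWinograd1990.lean`).

## References

* M. Bläser, *Fast Matrix Multiplication*, Theory of Computing Graduate Surveys 5 (2013), Def. 6.1,
  Thm. 6.3, Lemma 6.4, Thm. 6.6 (pp. 26–28). [Blaser2013]
* P. Bürgisser, M. Clausen, M. A. Shokrollahi, *Algebraic Complexity Theory* (1997), §15.4:
  Lemma (15.24)(3), Prop. (15.26), Lemma (15.27). [BurgisserClausenShokrollahi1997]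
* V. Vassilevska Williams, Y. Xu, Z. Xu, R. Zhou, *New bounds for matrix multiplication: from alpha
  to omega*, SODA 2024, arXiv:2307.07970, §3.6. [VassilevskaWilliamsXuXuZhou2024]
-/

noncomputable section

open scoped BigOperators Polynomial
open Filter Asymptotics Finset

namespace Literature.Computability.AlgebraicComplexity

universe u

/-! ## Approximate decompositions of Kronecker products and powers -/

section Kronecker

variable {K : Type u} [CommSemiring K]
variable {ι κ μ ι' κ' μ' : Type*}

/-- An approximate decomposition indexed by an arbitrary finite type bounds `R_h` by its
cardinality. [cite: Blaser2013, Def. 6.1] -/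
theorem approxRank_le_card_of_coeff {h : ℕ} {t : ι → κ → μ → K} {σ : Type*} [Fintype σ]
    (u : σ → ι → K[X]) (v : σ → κ → K[X]) (w : σ → μ → K[X])
    (H : ∀ a b c, ∀ j ≤ h, (∑ s, u s a * v s b * w s c).coeff j = if j = h then t a b c else 0) :
    approxRank h t ≤ Fintype.card σ := by
  set e := Fintype.equivFin σ
  refine approxRank_le_of_isApproxDecomposition (u := fun i a => u (e.symm i) a)
    (v := fun i b => v (e.symm i) b) (w := fun i c => w (e.symm i) c) ?_
  intro a b c j hj
  rw [← H a b c j hj]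
  congr 1
  exact Fintype.sum_equiv e.symm _ _ fun i => rfl

/-- **`R_{Nh}(t^{⊗N}) ≤ R_h(t)^N`** (iterate the product rule along `t^{⊗(N+1)} ≅ t ⊗ t^{⊗N}`; the
step "`R_{3hs}(⟨N^s,N^s,N^s⟩) ≤ r^{3s}`" of the proof of Bläser's Thm. 6.6). [cite: Blaser2013, Thm. 6.6 (proof)] -/
theorem approxRank_kroneckerPow_le [Fintype ι] [Fintype κ] [Fintype μ] [DecidableEq ι] [DecidableEq κ]
    [DecidableEq μ] (h : ℕ) (t : ι → κ → μ → K) (N : ℕ) :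
    approxRank (N * h) (kroneckerPow t N) ≤ approxRank h t ^ N := by
  induction N with
  | zero =>
    rw [zero_mul, pow_zero]
    refine (approxRank_le_card_of_coeff (σ := Unit) (fun _ _ => (1 : K[X])) (fun _ _ => 1)
      (fun _ _ => 1) ?_).trans (by simp)
    intro a b c j hj
    obtain rfl : j = 0 := Nat.le_zero.1 hj
    simp
  | succ N ih =>
    rw [kroneckerPow_succ_eq, show (N + 1) * h = h + N * h by ring, pow_succ']
    refine (approxRank_precomp_le _ _ _ _ _).trans ((approxRank_kroneckerTensor_le _ _ _ _).trans ?_)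
    exact Nat.mul_le_mul_left _ ih

end Kronecker

/-! ## Growth of the ranks of Kronecker powers under a border rank bound -/

section Growth

variable {K : Type u} [CommSemiring K]
variable {ι κ μ : Type*}

/-- **Border rank bounds the growth of the ranks of Kronecker powers**:
`R_h(t) ≤ r ⇒ R(t^{⊗N}) ≤ C(Nh+2, 2) · r^N` (BCS, proof of Lemma (15.27): "`R(φ^{⊗N}) ≤ (Nq)² r^N`").
[cite: BurgisserClausenShokrollahi1997, Lemma (15.27) (proof)] -/
theorem tensorRank_kroneckerPow_le_of_approxRank_le [Fintype ι] [Fintype κ] [Fintype μ] [DecidableEq ι]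
    [DecidableEq κ] [DecidableEq μ] {h r : ℕ} {t : ι → κ → μ → K} (ht : approxRank h t ≤ r) (N : ℕ) :
    tensorRank (kroneckerPow t N) ≤ (N * h + 2).choose 2 * r ^ N :=
  (tensorRank_le_choose_mul_approxRank (N * h) _).trans
    (Nat.mul_le_mul_left _ ((approxRank_kroneckerPow_le h t N).trans (Nat.pow_le_pow_left ht N)))

/-- `C(Nh+2, 2) ≤ (h+2)² N²` for `N ≥ 1`. [folklore] -/
theorem choose_mul_add_two_le {h N : ℕ} (hN : 1 ≤ N) : (N * h + 2).choose 2 ≤ (h + 2) ^ 2 * N ^ 2 := by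
  calc (N * h + 2).choose 2 ≤ (N * h + 2) ^ 2 := Nat.choose_le_pow _ _
    _ ≤ ((h + 2) * N) ^ 2 := Nat.pow_le_pow_left (by nlinarith) 2
    _ = (h + 2) ^ 2 * N ^ 2 := by ring

/-- **Growth form** (the unfolded "`R̃(t) ≤ r`" used by `CoppersmithWinograd1990_asymptoticRank_form`):
if `R_h(t) ≤ r` with `r ≥ 2` then `R(t^{⊗N}) = O(r^{(1+ε)N})` for every `ε > 0` (BCS Lemma (15.27):
`limsup_N (1/N) log R(φ^{⊗N}) ≤ log bR(φ)`). [cite: BurgisserClausenShokrollahi1997, Lemma (15.27)] -/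
theorem isBigO_tensorRank_kroneckerPow_of_approxRank_le [Fintype ι] [Fintype κ] [Fintype μ]
    [DecidableEq ι] [DecidableEq κ] [DecidableEq μ] {h r : ℕ} {t : ι → κ → μ → K}
    (ht : approxRank h t ≤ r) (hr : 2 ≤ r) {ε : ℝ} (hε : 0 < ε) :
    (fun N : ℕ => (tensorRank (kroneckerPow t N) : ℝ)) =O[atTop]
      fun N : ℕ => (r : ℝ) ^ ((1 + ε) * N) := by
  have hr0 : (0 : ℝ) < r := by exact_mod_cast (by omega : 0 < r)
  have hrε : 1 < (r : ℝ) ^ ε := Real.one_lt_rpow (by exact_mod_cast (by omega : 1 < r)) hε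
  -- the polynomial factor is `O((r^ε)^N)`
  have h1 : (fun N : ℕ => (((N * h + 2).choose 2 : ℕ) : ℝ)) =O[atTop] fun N : ℕ => ((r : ℝ) ^ ε) ^ N := by
    have hpoly : (fun N : ℕ => (((N * h + 2).choose 2 : ℕ) : ℝ)) =O[atTop] fun N : ℕ => (N : ℝ) ^ 2 := by
      refine IsBigO.of_bound ((h + 2) ^ 2 : ℝ) ?_
      filter_upwards [eventually_ge_atTop 1] with N hN
      rw [Real.norm_of_nonneg (Nat.cast_nonneg _), Real.norm_of_nonneg (by positivity)]
      exact_mod_cast choose_mul_add_two_le (h := h) hN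
    exact hpoly.trans (isLittleO_pow_const_const_pow_of_one_lt 2 hrε).isBigO
  -- the rank bound, pointwise
  have h2 : ∀ N : ℕ, (tensorRank (kroneckerPow t N) : ℝ) ≤
      (((N * h + 2).choose 2 : ℕ) : ℝ) * (r : ℝ) ^ N := fun N => by
    exact_mod_cast tensorRank_kroneckerPow_le_of_approxRank_le ht N
  have h3 : (fun N : ℕ => (tensorRank (kroneckerPow t N) : ℝ)) =O[atTop]
      fun N : ℕ => (((N * h + 2).choose 2 : ℕ) : ℝ) * (r : ℝ) ^ N :=
    IsBigO.of_bound 1 (Eventually.of_forall fun N => by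
      rw [one_mul, Real.norm_of_nonneg (Nat.cast_nonneg _), Real.norm_of_nonneg (by positivity)]
      exact h2 N)
  refine h3.trans ((h1.mul (isBigO_refl (fun N : ℕ => (r : ℝ) ^ N) atTop)).trans ?_)
  refine IsBigO.of_bound 1 (Eventually.of_forall fun N => ?_)
  rw [one_mul, Real.norm_of_nonneg (by positivity), Real.norm_of_nonneg (by positivity)]
  apply le_of_eq
  rw [← Real.rpow_natCast ((r : ℝ) ^ ε) N, ← Real.rpow_mul hr0.le, ← Real.rpow_natCast (r : ℝ) N,
    ← Real.rpow_add hr0]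
  congr 1
  ring

/-- The same from the border rank: `bR(t) ≤ r`, `r ≥ 2` `⇒ R(t^{⊗N}) = O(r^{(1+ε)N})` for every
`ε > 0` (BCS Lemma (15.27)). [cite: BurgisserClausenShokrollahi1997, Lemma (15.27)] -/
theorem isBigO_tensorRank_kroneckerPow_of_algBorderRank_le [Fintype ι] [Fintype κ] [Fintype μ]
    [DecidableEq ι] [DecidableEq κ] [DecidableEq μ] {r : ℕ} {t : ι → κ → μ → K}
    (ht : algBorderRank t ≤ r) (hr : 2 ≤ r) {ε : ℝ} (hε : 0 < ε) :
    (fun N : ℕ => (tensorRank (kroneckerPow t N) : ℝ)) =O[atTop]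
      fun N : ℕ => (r : ℝ) ^ ((1 + ε) * N) := by
  -- `bR(t) = min_h R_h(t)` is attained at some `h`
  obtain ⟨h, hh⟩ : ∃ h : ℕ, approxRank h t = algBorderRank t := by
    have := ciInf_mem (fun h : ℕ => approxRank h t)
    exact this
  exact isBigO_tensorRank_kroneckerPow_of_approxRank_le (hh.le.trans ht) hr hε

end Growth

end Literature.Computability.AlgebraicComplexity

end
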